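import Literature.NumberTheory.Automorphic.ShimuraCurveRibetTakahashiPairwiseNoJLProofs
import Literature.NumberTheory.Automorphic.BrandtSetupAdmissible
import Literature.NumberTheory.EllipticCurves.TakahashiDegreeFormula
import Literature.NumberTheory.EllipticCurves.IsogenyConductorProofs
import HarnessLib

/-!
# Pasten's two-prime package from Takahashi's degree formulae, in the tree's Brandt-module
# vocabulary

Topic `NumberTheory/Automorphic`; a proofs-only companion (theorems only: no definition, no named
fact, nothing restated; D-0026) of `ShimuraCurveRibetTakahashi.lean`, for its named fact
`Literature.NumberTheory.Automorphic.PastenShimura2024_pairwise_denominator` (H. Pasten, *Shimura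
curves and the abc conjecture*, J. Number Theory 254 (2024) = arXiv:1705.09251, §6.9
(EqSequentially) p. 25 at `d = 1`, with Lemmas 6.8, 6.14, 6.15).

**The point.** The tree's assemblies of the package (`…PairwiseDenominatorProofs`,
`…PairwiseNoJLProofs`) take Pasten's geometric inputs — Prop. 6.13 (`h613`), "`j_p ∣ c_p(A_{D,M})`"
(`hJc`), the Eisenstein divisibility (`hEis`), at ALL levels `(d, D)` — as free hypotheses over
abstract, undefined functions `cI cJ` ("the orders `i_p`, `j_p` of image and cokernel of
`Φ_p(J₀^D(M)) → Φ_p(A_{D,M})`"), because the tree has no Néron models of Jacobians in which to state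
them. But the tree DOES have the coordinates in which Ribet–Takahashi and Takahashi compute these
numbers: the Brandt module of an Eichler order in a definite quaternion algebra (`BrandtXi.lean`:
`Brandt.XiSetup N⁺ N⁻`, `S.xi`; setups exist, `Brandt.nonempty_xiSetup_iff_admissible`), already used
by the tree's NAMED FACT `Literature.NumberTheory.EllipticCurves.takahashi2001_thm_2_3_of_coprime`
(Takahashi 2001, Thm. 2.3 at `D = 1`: `δ_{1,N} · i_r = ξ · j_r`, `i_r j_r = c_r(A_{1,N})`, `i_r ∣ ξ`,
`ξ = h_r` the monodromy self-pairing of the `a(f)`-eigenline of `X_r(J₀(N)) ≅ ℤ[Cls O]⁰`). In those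
coordinates Prop. 6.13 at `d = 1` DECOMPOSES into two instances of Takahashi's Thm. 2.3 with the
same `ξ` (Takahashi 2001, Thm. 3.2 (a) `h_q = h'_p`, from Ribet's exact sequence Prop. 3.1 =
Ribet–Takahashi 1997, Prop. 1 — the proof of Ribet–Takahashi's Thm. 2 itself): for `N = pq · M`,

  `δ_{1,N} · i_q(1,N) = ξ · j_q(1,N)`  (Thm. 2.3 for `X₀(N)` at `q ∥ N`, setups of type `(pM, q)`),
  `δ_{pq,M} · i_p(pq,M) = ξ · j_p(pq,M)` (Thm. 2.3 for `X₀^{pq}(M)` at `p ∣ D`, the SAME setups),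

whence, multiplying out (`i j = c`), `δ_{1,N} i_q(1,N)² j_p(pq,M)² = δ_{pq,M} c_q(A_{1,N}) c_p(A_{pq,M})`
— Prop. 6.13, second line; the first line symmetrically from the setups of type `(qM, p)` — with
no appeal to Takahashi's Thm. 2.4 (`j_p = 1` for `p ∣ D`, whose proof has a gap: Pasten, remark after
Lemma 6.14, citing Papikian–Rabinoff). Checked on Takahashi's Table I (p. 87, `N = pq < 100`):
`14A`: `1·9·1 = 1·3·3`; `26B`: `2 = 2`; `57C`: `12·1·1 = 6·1·2` and `12·25·1 = 6·10·5`.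

So this file proves the package from:

* the tree's named facts `takahashi2001_thm_2_3_of_coprime` (`hT1`) and
  `mazurKenku_exists_cyclic_isogeny` (`hMK`, Lemma 6.8), and
* THREE PRINTED THEOREMS stated here, over the tree's vocabulary, as hypotheses (this proving seat
  may not vendor them as named facts, D-0026; each is a self-contained statement ready to be
  vendored by a literature pass, and the hypotheses below are then fed by those facts verbatim):
  (`hT2`) Takahashi 2001, Thm. 2.3 for `X₀^D(M)` at a prime `p ∣ D` with Thm. 3.2 (a) — `δ_D(M) i_p
  = ξ j_p`, `i_p j_p = c_p(A_{D,M})`, `i_p ∣ ξ`, `ξ` over the setups of type `(pM, D/p)` (p. 84: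
  `X_q(J₀^{d}(q m'))`, `ω(dq)` odd, is the degree-`0` Brandt module of the Eichler order of level `m'`
  in the definite algebra of discriminant `dq`, pairing-compatibly); (`hEis`) Ribet 1990, Thm. 3.12
  as used in Pasten's proof of Lemma 6.14 ("`i_p(J₀^D(M), χ)` divides `r + 1 − a_r(A_{D,M})` for
  every prime `r ∤ N`") at `D = 1`, in Takahashi's coordinates — for every solution `(i, j)` of
  `i j = c_r`, `δ i = ξ j` (there is exactly one, `unique_image`, namely `(i_r, j_r)` by Thm. 2.3);
  (`h67`) Pasten's Lemma 6.7 (uniform non-Eisenstein primes), verbatim the `h67` of the sibling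
  files;
* one level input outside Pasten's §6 (`hlev`): the curve `W₁ ≅ A_{1,N}` carrying the statement's
  classical datum `D₁` has conductor `N` (Takahashi's fact is stated with the conductor of the
  datum's own curve) — by Carayol's theorem (`_of_carayol`, tree fact
  `IsNewformOf.level_eq_conductorNorm`, a theorem of the tree granted modularity), or by Faltings
  (`W₁ ∼ W`, tree theorem `isIsogenous_of_lFunction_prime_eq_of_not_dvd`) and the isogeny invariance
  of the conductor (`_of_isogenyConductor`), i.e. Ogg–Saito (`_of_oggSaito`, tree
  `conductorNorm_eq_of_isIsogenous_of_tate`; unconditional unless additive at `2`, Saito 1988).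

Everything else — Lemma 6.14 for ONE integer (from `hEis` and `h67`), `j ∣ c` (from `i j = c`),
Lemma 6.15 (switching `p ↔ q` between the two lines), §6.9 — is Pasten's printed argument, run with
the flat valuation lemmas of `…CokernelProofs` / `…PairwiseDenominatorProofs` and the final
calculation of `…PairwiseNoJLProofs` verbatim. Compared with
`PastenShimura2024_pairwise_denominator_of_ribetTakahashi_eisenstein_mazurKenku_noJL`: no undefined
function, no hypothesis at levels other than `(1, N)` and `(pq, M)`, `hJc` gone, `h613` replaced by
Takahashi's two one-level formulae, one of which is already a declaration of the tree.

## References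

* H. Pasten, J. Number Theory 254 (2024) = arXiv:1705.09251: Lemma 6.7/6.8 p. 22, Prop. 6.13 and
  Lemma 6.14 p. 23, Lemma 6.15 p. 24, §6.9 (EqSequentially) p. 25 (held text, read).
  [PastenShimura2024]
* S. Takahashi, J. Number Theory 90 (2001) 74–88: §2 (Lemma 2.2, Thm. 2.3 p. 79, remark p. 80), §3.1
  (Prop. 3.1, Thm. 3.2 (a) p. 82), §3.2 p. 84, Table I p. 87 (held text, read). [Takahashi2001]
* K. A. Ribet, S. Takahashi, PNAS 94 (1997), Prop. 1–3, Thm. 2 (Prop. 3, proof: "`Φ(J,q)` is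
  Eisenstein … proved by the first author in case `D = 1`, Theorem 3.12 of [Ribet1990]").
  [RibetTakahashi1997]
* K. A. Ribet, Invent. Math. 100 (1990), Thm. 3.12, Thm. 4.1 [Ribet1990]; K. A. Ribet, Sém. Théor.
  Nombres Bordeaux 1987–88, exp. 6 [RibetComponentGroups1988]; B. Edixhoven, Astérisque 196–197
  (1991) 159–170 [EdixhovenEisenstein1991].
* B. Mazur, Invent. Math. 44 (1978), Thm. 1 [Mazur1978]; M. A. Kenku, J. Number Theory 15 (1982)
  [Kenku1982]; G. Faltings, Invent. Math. 73 (1983), §5 Kor. 2 [Faltings1983Endlichkeit].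

## Mathlib / tree search

Tree (reused): `takahashi2001_thm_2_3_of_coprime`, `Brandt.nonempty_xiSetup_iff_admissible`,
`isIsogenous_of_lFunction_prime_eq_of_not_dvd`, `LFunction_eq_of_isIsogenous_holds`,
`lemma_6_8_factorization_form`, `PastenShimura2024_lemma_6_8_of_mazurKenku'`,
`factorization_minimalDiscriminantNorm_pos_of_dvd`, `IsAdmissibleFactorization.dvd_and_not_sq_dvd`,
`factorization_le_of_two_identities`, `factorization_le_of_dvd_of_mul_eq_mul`,
`factorization_le_of_dvd_of_ne_zero`, `dvd_prod_pow_of_factorization_le`,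
`dvd_gcd_mul_prod_pow_of_factorization_le`, `one_le_prod_pow_and_primeFactors_lt`,
`conductorNorm_eq_of_isIsogenous_of_tate`, `IsIsogenous.symm_of_charZero`. No Néron model /
component group of a Jacobian exists in Mathlib or the tree; none is needed here.
-/

noncomputable section

open scoped MatrixGroups ModularForm

namespace Literature.NumberTheory.Automorphic

open Literature.NumberTheory.EllipticCurves (mazurKenku_exists_cyclic_isogeny
  LFunction_eq_of_isIsogenous_holds takahashi2001_thm_2_3_of_coprime
  conductorNorm_eq_of_isIsogenous_of_tate)
open Literature.NumberTheory.EllipticCurves.ModularForms (ModularParametrizationData IsNewformOf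
  PastenShimura2024_lemma_6_8_of_mazurKenku')

/-! ## I. Lemma 6.14 for one integer: `i ∣ κ_S` from the Eisenstein divisibility and Lemma 6.7 -/

/-- **Pasten 2024, Lemma 6.14, pointwise.** From Lemma 6.7 for the finite set `S` (p. 22: for every
prime `ℓ` an integer `β_S(ℓ)`, `= 1` for `ℓ > 163`, such that every `A/ℚ` semistable away from `S`
has infinitely many primes `r` with `a_r(A) ≢ r + 1 mod ℓ^{β_S(ℓ)}`): one integer `κ_S ≥ 1`
supported on primes `≤ 163` such that for every elliptic `A/ℚ` of conductor `N ≥ 1` squarefree away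
from `S` and every `i ≥ 1` with `i ∣ r + 1 − a_r(A)` for all primes `r ∤ N`, one has `i ∣ κ_S`.
Proof as printed (p. 23): for a prime `ℓ`, a prime `r > N` with `ℓ^{β_S(ℓ)} ∤ r + 1 − a_r(A)` gives
`v_ℓ(i) ≤ β_S(ℓ) − 1`; `κ_S = ∏_{ℓ ≤ 163} ℓ^{β_S(ℓ) − 1}` (the tree's `PastenShimura2024_lemma_6_14`,
for one number instead of a function of data). [cite: PastenShimura2024, Lemma 6.14 p. 23 (statement and proof), Lemma 6.7 p. 22] -/
theorem exists_dvd_of_eisenstein_of_lemma_6_7 {S : Finset ℕ}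
    (h67 : ∀ ℓ : ℕ, ℓ.Prime → ∃ β : ℕ, (163 < ℓ → β = 1) ∧
      ∀ (A : WeierstrassCurve ℚ) [A.IsElliptic],
        (∀ q : ℕ, q.Prime → q ∉ S → ¬ q ^ 2 ∣ A.conductorNorm ℤ) →
        ∀ r₀ : ℕ, ∃ r : ℕ, r₀ < r ∧ r.Prime ∧ ¬ ((ℓ ^ β : ℕ) : ℤ) ∣ (r + 1 : ℤ) - A.LFunction r) :
    ∃ κ₁ : ℕ, 1 ≤ κ₁ ∧ (∀ q ∈ κ₁.primeFactors, q ≤ 163) ∧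
      ∀ (A : WeierstrassCurve ℚ) [A.IsElliptic] {N : ℕ}, 0 < N → A.conductorNorm ℤ = N →
        (∀ q : ℕ, q.Prime → q ∉ S → ¬ q ^ 2 ∣ N) →
        ∀ {i : ℕ}, 0 < i →
          (∀ r : ℕ, r.Prime → ¬ r ∣ N → (i : ℤ) ∣ (r + 1 : ℤ) - A.LFunction r) → i ∣ κ₁ := by
  classical
  choose β hβ1 hβ2 using h67
  let α : ℕ → ℕ := fun ℓ => if h : ℓ.Prime then β ℓ h - 1 else 0
  have hα0 : ∀ ℓ : ℕ, ℓ.Prime → 164 ≤ ℓ → α ℓ = 0 := by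
    intro ℓ hℓ h164
    show (if h : ℓ.Prime then β ℓ h - 1 else 0) = 0
    rw [dif_pos hℓ, hβ1 ℓ hℓ (by omega)]
  refine ⟨∏ ℓ ∈ (Finset.range 164).filter Nat.Prime, ℓ ^ α ℓ,
    (one_le_prod_pow_and_primeFactors_lt 164 α).1,
    fun q hq => Nat.lt_succ_iff.mp ((one_le_prod_pow_and_primeFactors_lt 164 α).2 q hq), ?_⟩
  intro A _ N hN hAN hS i hi hEis
  refine dvd_prod_pow_of_factorization_le hi.ne' (fun ℓ hℓ => ?_) hα0
  -- a prime `r > N` (so `r ∤ N`) with `a_r(A) ≢ r + 1 mod ℓ^β`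
  obtain ⟨r, hrN, hr, hndvd⟩ := hβ2 ℓ hℓ A (fun q hq hqS => by rw [hAN]; exact hS q hq hqS) N
  have hrN' : ¬ r ∣ N := fun h => absurd hrN (not_lt.mpr (Nat.le_of_dvd hN h))
  have hdvd := hEis r hr hrN'
  -- hence `v_ℓ(i) < β`
  have hlt : i.factorization ℓ < β ℓ hℓ := by
    by_contra hge
    push Not at hge
    exact hndvd ((Int.natCast_dvd_natCast.mpr
      ((pow_dvd_pow ℓ hge).trans (Nat.ordProj_dvd _ ℓ))).trans hdvd)
  show _ ≤ (if h : ℓ.Prime then β ℓ h - 1 else 0)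
  rw [dif_pos hℓ]
  omega

/-! ## II. Takahashi's coordinates: the pair `(i_r, j_r)` is pinned by Thm. 2.3 -/

/-- **The system of Thm. 2.3 pins `i`**: if `(i, j)` and `(i', j')` both satisfy `i j = c`,
`δ i = h j` with `δ ≥ 1`, then `i = i'` — Takahashi's equations `i_r j_r = c_r`,
`δ · i_r = h_r · j_r` (Thm. 2.3, p. 79) have exactly one solution, so a statement "for every
solution `(i, j)` …" (hypothesis `hEis` below) speaks about the one integer `i_r`.
[cite: Takahashi2001, Thm. 2.3 (p. 79)] -/
theorem unique_image {δ h c i j i' j' : ℕ} (hδ : 0 < δ) (h₁ : i * j = c) (h₂ : δ * i = h * j)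
    (h₁' : i' * j' = c) (h₂' : δ * i' = h * j') : i = i' := by
  have key : δ * (i * i) = δ * (i' * i') := by
    calc δ * (i * i) = (δ * i) * i := by ring
      _ = h * j * i := by rw [h₂]
      _ = h * (i * j) := by ring
      _ = h * (i' * j') := by rw [h₁, h₁']
      _ = (h * j') * i' := by ring
      _ = δ * i' * i' := by rw [h₂']
      _ = δ * (i' * i') := by ring
  have h2 : i * i = i' * i' := Nat.eq_of_mul_eq_mul_left hδ key
  nlinarith [sq_nonneg (i - i' : ℤ), sq_nonneg (i + i' : ℤ), Nat.mul_self_inj.mp h2]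

section Inputs

/-! ### The three printed inputs, over the tree's vocabulary -/

variable
  /- (`hT2`) **Takahashi 2001, Thm. 2.3 for `X₀^D(M)` at a prime `p ∣ D`, with Thm. 3.2 (a)**
  (p. 79: "`i_r` divides `h_r`, and `δ = (h_r/i_r) · j_r`", any prime `r ∣ N`, here `r = p ∣ D`;
  p. 82: "`h_q = h'_p`" for `J = J₀^d(pqm)`, `J' = J₀^{dpq}(m)`; p. 84: `X_q(J₀^{d}(q m'))`, `ω(dq)`
  odd, is the degree-`0` Brandt module of the Eichler order of level `m'` in the definite algebra of
  discriminant `dq`, Hecke- and pairing-compatibly). Rendering as in the Pasten facts of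
  `ShimuraCurveRibetTakahashi.lean`: `N = DM` admissible, `D = p · d`, `W/ℚ` of conductor `N`
  fixing the class, `P` on `X : ShimuraCurveData D M` with `P.IsMinimalFor W` (`P.deg = δ_{D,M}`,
  the datum's curve `W' ≅ A_{D,M}`, `c_p(A_{D,M}) = ord_p Δ_min(W')`), `h_p = S.xi (a(W'))` for the
  setups `S` of type `(pM, d)`; scope beyond square-free `N` as in `takahashi2001_thm_2_3_of_coprime`
  (Pasten Prop. 6.13 and its remark). -/
  (hT2 : ∀ {N D M p d : ℕ}, p.Prime → D = p * d → IsAdmissibleFactorization N D M →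
    ∀ (X : ShimuraCurveData D M) (W : WeierstrassCurve ℚ) [W.IsElliptic],
      W.conductorNorm ℤ = N →
    ∀ (W' : WeierstrassCurve ℚ) [W'.IsElliptic] (P : ShimuraParametrizationData X W'),
      P.IsMinimalFor W →
    ∀ S : Brandt.XiSetup (p * M) d,
      ∃ i j : ℕ, 0 < i ∧ i * j = (W'.minimalDiscriminantNorm ℤ).factorization p ∧
        i ∣ S.xi (fun n => W'.LFunction n) ∧
        P.deg * i = S.xi (fun n => W'.LFunction n) * j)
  /- (`hEis`) **Ribet 1990, Thm. 3.12 (the component group of `J₀(N)` at `r ∥ N` is Eisenstein), as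
  used in Pasten's proof of Lemma 6.14** (p. 23: "`i_p(J₀^D(M), χ_{D,M})` divides
  `r + 1 − a_r(A_{D,M})` for every prime `r ∤ N`"; Ribet–Takahashi 1997, proof of Prop. 3), at
  `D = 1`, in the coordinates and under the hypotheses of `takahashi2001_thm_2_3_of_coprime`: for every
  solution `(i, j)` of `i j = ord_r Δ_min(W)`, `δ_{1,N} i = S.xi (a(W)) j` (i.e. for `(i_r, j_r)`,
  `unique_image`) and every prime `ℓ ∤ N`: `i ∣ ℓ + 1 − a_ℓ(W)`. -/
  (hEis : ∀ (W : WeierstrassCurve ℚ) [W.IsElliptic] (M r : ℕ) [NeZero (M * r)],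
    r.Prime → M.Coprime r → W.conductorNorm ℤ = M * r →
    ∀ P : ModularParametrizationData W (M * r),
      (∀ (W' : WeierstrassCurve ℚ) [W'.IsElliptic], W'.conductorNorm ℤ = M * r →
          ∀ P' : ModularParametrizationData W' (M * r),
          P'.f = P.f → P.modularDegree ≤ P'.modularDegree) →
      ∀ (S : Brandt.XiSetup M r) (i j : ℕ), 0 < i →
        i * j = (W.minimalDiscriminantNorm ℤ).factorization r →
        P.modularDegree * i = S.xi (fun n => W.LFunction n) * j →
        ∀ ℓ : ℕ, ℓ.Prime → ¬ ℓ ∣ M * r → (i : ℤ) ∣ (ℓ + 1 : ℤ) - W.LFunction ℓ)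
  /- (`h67`) **Pasten 2024, Lemma 6.7** (p. 22: "For all primes `ℓ` there is an integer `β_S(ℓ)` …
  (i) If `ℓ > 163`, then `β_S(ℓ) = 1`. (ii) For every elliptic curve `A/ℚ` semi-stable away from `S`,
  there are infinitely many primes `r` such that `a_r(A) ≢ r + 1 mod ℓ^{β_S(ℓ)}`"), verbatim the
  `h67` of the sibling files. -/
  (h67 : ∀ (S : Finset ℕ) (ℓ : ℕ), ℓ.Prime → ∃ β : ℕ, (163 < ℓ → β = 1) ∧
    ∀ (A : WeierstrassCurve ℚ) [A.IsElliptic],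
      (∀ q : ℕ, q.Prime → q ∉ S → ¬ q ^ 2 ∣ A.conductorNorm ℤ) →
      ∀ r₀ : ℕ, ∃ r : ℕ, r₀ < r ∧ r.Prime ∧ ¬ ((ℓ ^ β : ℕ) : ℤ) ∣ (r + 1 : ℤ) - A.LFunction r)

include hEis in
/-- `takahashi2001_thm_2_3_of_coprime` at a level `N` with `N = M r` given as an equation (so that a
datum `P : ModularParametrizationData W N` need not be transported along `N = M r`), together with
the Eisenstein divisibility for the same pair `(i, j)`.
[cite: Takahashi2001, Thm. 2.3 (p. 79)] [cite: PastenShimura2024, Lemma 6.14 p. 23 (proof)] -/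
theorem exists_image_coker_of_eq_mul (hT1 : takahashi2001_thm_2_3_of_coprime) {N : ℕ} [NeZero N]
    (W : WeierstrassCurve ℚ) [W.IsElliptic] {M r : ℕ} (hN : N = M * r) (hr : r.Prime)
    (hMr : M.Coprime r) (hW : W.conductorNorm ℤ = N) (P : ModularParametrizationData W N)
    (hmin : ∀ (W' : WeierstrassCurve ℚ) [W'.IsElliptic] (P' : ModularParametrizationData W' N),
      P'.f = P.f → P.modularDegree ≤ P'.modularDegree)
    (S : Brandt.XiSetup M r) :
    ∃ i j : ℕ, 0 < i ∧ i * j = (W.minimalDiscriminantNorm ℤ).factorization r ∧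
      P.modularDegree * i = S.xi (fun n => W.LFunction n) * j ∧
      ∀ ℓ : ℕ, ℓ.Prime → ¬ ℓ ∣ N → (i : ℤ) ∣ (ℓ + 1 : ℤ) - W.LFunction ℓ := by
  subst hN
  have hmin' : ∀ (W' : WeierstrassCurve ℚ) [W'.IsElliptic], W'.conductorNorm ℤ = M * r →
      ∀ P' : ModularParametrizationData W' (M * r), P'.f = P.f →
        P.modularDegree ≤ P'.modularDegree := fun W' _ _ P' hf => hmin W' P' hf
  obtain ⟨i, j, hi, hij, -, hδ⟩ := hT1 W M r hr hMr hW P hmin' S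
  exact ⟨i, j, hi, hij, hδ, hEis W M r hr hMr hW P hmin' S i j hi hij hδ⟩

/-! ## III. The two-prime package -/

include hT2 hEis h67 in
/-- **Pasten 2024, the pairwise `gcd`-bounded denominator of `γ_{pq,M,E}`, from Takahashi's degree
formulae — the core, with the level input `hlev` explicit.** Hypotheses: the tree's facts
`takahashi2001_thm_2_3_of_coprime`, `mazurKenku_exists_cyclic_isogeny`; the printed inputs `hT2`,
`hEis`, `h67` of this section; and `hlev` — the curve `W₁` of a classical datum `D₁` at level `N`
whose newform is that of a curve `W` of conductor `N` has conductor `N` (see the three corollaries).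
Proof (module docstring): Brandt setups of types `(pM, q)` and `(qM, p)` exist; Thm. 2.3 at `D = 1`
for `q` and for `p` on `D₁` (`W₁ ≅ A_{1,N}`), and for `X₀^{pq}(M)` at `p` and at `q` on `P`
(`W' ≅ A_{pq,M}`), with `ξ(a(W₁)) = ξ(a(W'))` (`a` is an isogeny invariant; `W₁ ∼ W` by Faltings),
give both lines of Prop. 6.13 at `d = 1`; `j'_p ∣ c_p(W')`, `j'_q ∣ c_q(W')` (`i j = c`); Lemma 6.8
four times; Lemma 6.14 for `i_p(1,N)`, `i_q(1,N)`; Lemma 6.15 for `j_q(pq,M)` against `r = q` (same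
prime) and `r = p` (switch, `factorization_le_of_two_identities`); then §6.9 exactly as in
`PastenShimura2024_pairwise_denominator_of_lemmas_of_supply`: `a = a₁a₂ ≤ 163²`,
`b = i_p² j_q² b₁b₂ ≤ (163² κ_S² κ'²) gcd(c_p, c_q)²`, `δ_{1,N} b = a δ_{pq,M} c_p(E) c_q(E)`.
[cite: PastenShimura2024, §6.9 (EqSequentially) p. 25 with d = 1, Prop. 6.13 and Lemma 6.14 p. 23, Lemma 6.15 p. 24, Lemma 6.7 and 6.8 p. 22] [cite: Takahashi2001, Thm. 2.3 (p. 79), Prop. 3.1 and Thm. 3.2 (a) (p. 82), p. 84] -/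
theorem PastenShimura2024_pairwise_denominator_of_takahashi_of_level
    (hT1 : takahashi2001_thm_2_3_of_coprime) (hMK : mazurKenku_exists_cyclic_isogeny)
    (hlev : ∀ {N : ℕ} [NeZero N] {W₁ : WeierstrassCurve ℚ} [W₁.IsElliptic]
      (D₁ : ModularParametrizationData W₁ N) (W : WeierstrassCurve ℚ) [W.IsElliptic],
      IsNewformOf W D₁.f → W.conductorNorm ℤ = N → W₁.conductorNorm ℤ = N) :
    PastenShimura2024_pairwise_denominator := by
  intro S
  obtain ⟨κ₁, hκ₁, hκ₁', h614⟩ := exists_dvd_of_eisenstein_of_lemma_6_7 (h67 S)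
  -- the constant `κ' = ∏_{ℓ ≤ 163} ℓ^{α_{S,1}(ℓ)}` of Lemma 6.15, `α = v_ℓ(κ_S) + 3 log_ℓ 163`,
  -- and `κ = 163² κ_S² κ'²`
  set α : ℕ → ℕ := fun ℓ => κ₁.factorization ℓ + 3 * Nat.log ℓ 163 with hαdef
  have hα0 : ∀ ℓ : ℕ, ℓ.Prime → 164 ≤ ℓ → α ℓ = 0 := by
    intro ℓ hℓ h164
    have h1 : κ₁.factorization ℓ = 0 := by
      apply Finsupp.notMem_support_iff.mp
      rw [Nat.support_factorization]
      exact fun hmem => absurd (hκ₁' ℓ hmem) (by omega)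
    have h2 : Nat.log ℓ 163 = 0 := Nat.log_of_lt (by omega)
    show κ₁.factorization ℓ + 3 * Nat.log ℓ 163 = 0
    rw [h1, h2]
  set K := ∏ ℓ ∈ (Finset.range 164).filter Nat.Prime, ℓ ^ α ℓ with hK
  have hK1 : 1 ≤ K := (one_le_prod_pow_and_primeFactors_lt 164 α).1
  refine ⟨163 ^ 2 * κ₁ ^ 2 * K ^ 2, Nat.one_le_iff_ne_zero.mpr (mul_ne_zero (mul_ne_zero
    (pow_ne_zero 2 (by norm_num)) (pow_ne_zero 2 (by omega))) (pow_ne_zero 2 (by omega))), ?_⟩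
  intro N M p q _ hp hq hpq hadm X W _ _ hWN hS W₁ _ D₁ hf hmin W' _ P hPm
  -- `p, q ∥ N`, so `c_p(E), c_q(E) ≥ 1`
  have hpD : p ∣ p * q := Dvd.intro q rfl
  have hqD : q ∣ p * q := Dvd.intro_left p rfl
  obtain ⟨hpN, hp2N⟩ := hadm.dvd_and_not_sq_dvd hp hpD
  obtain ⟨hqN, hq2N⟩ := hadm.dvd_and_not_sq_dvd hq hqD
  have hpN' : p ∣ W.conductorNorm ℤ := hWN ▸ hpN
  have hp2N' : ¬ p ^ 2 ∣ W.conductorNorm ℤ := hWN ▸ hp2N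
  have hqN' : q ∣ W.conductorNorm ℤ := hWN ▸ hqN
  have hq2N' : ¬ q ^ 2 ∣ W.conductorNorm ℤ := hWN ▸ hq2N
  have hcpE := factorization_minimalDiscriminantNorm_pos_of_dvd W hp hpN'
  have hcqE := factorization_minimalDiscriminantNorm_pos_of_dvd W hq hqN'
  -- the two ways of writing the level, `N = (pM) q = (qM) p`, and the coprimality conditions
  have hMpos : 0 < M := Nat.pos_of_ne_zero fun hM0 => by
    have h := hadm.mul_eq
    rw [hM0, mul_zero] at h
    exact absurd h hadm.pos.ne
  have hNq : N = p * M * q := by rw [← hadm.mul_eq]; ring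
  have hNp : N = q * M * p := by rw [← hadm.mul_eq]; ring
  have hqM : Nat.Coprime q M := Nat.Coprime.coprime_dvd_left hqD hadm.coprime
  have hpM : Nat.Coprime p M := Nat.Coprime.coprime_dvd_left hpD hadm.coprime
  have hpq' : Nat.Coprime p q := (Nat.coprime_primes hp hq).mpr hpq
  have hcop_q : Nat.Coprime (p * M) q := Nat.coprime_mul_iff_left.mpr ⟨hpq', hqM.symm⟩
  have hcop_p : Nat.Coprime (q * M) p := Nat.coprime_mul_iff_left.mpr ⟨hpq'.symm, hpM.symm⟩
  -- Brandt setups of types `(pM, q)` and `(qM, p)` exist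
  have hodd : ∀ {r : ℕ}, r.Prime → Odd r.primeFactors.card := fun hr => by
    rw [Nat.Prime.primeFactors hr, Finset.card_singleton]; exact odd_one
  obtain ⟨Sq⟩ : Nonempty (Brandt.XiSetup (p * M) q) := Brandt.nonempty_xiSetup_iff_admissible.mpr
    ⟨Nat.mul_pos hp.pos hMpos, hq.prime.squarefree, hodd hq, hcop_q⟩
  obtain ⟨Sp⟩ : Nonempty (Brandt.XiSetup (q * M) p) := Brandt.nonempty_xiSetup_iff_admissible.mpr
    ⟨Nat.mul_pos hq.pos hMpos, hp.prime.squarefree, hodd hp, hcop_p⟩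
  -- `W₁ ∼ W ∼ W'` (Faltings; `IsMinimalFor`): equal `a_n`; conductor `N_{W₁} = N`
  have hiso₁ : W₁.IsIsogenous W :=
    isIsogenous_of_lFunction_prime_eq_of_not_dvd (N₀ := 1) one_ne_zero fun ℓ _ _ => by
      have h := (D₁.isNewformOf.2 ℓ).symm.trans (hf.2 ℓ)
      exact_mod_cast h
  have hiso₁' : W.IsIsogenous W₁ := hiso₁.symm_of_charZero
  have hW₁N : W₁.conductorNorm ℤ = N := hlev D₁ W hf hWN
  have hL₁ : W₁.LFunction = W.LFunction := LFunction_eq_of_isIsogenous_holds W₁ W hiso₁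
  have hL' : W'.LFunction = W.LFunction := (LFunction_eq_of_isIsogenous_holds W W' hPm.1).symm
  -- Thm. 2.3 at `D = 1` for `q ∥ N` and `p ∥ N` (with the Eisenstein divisibility), on `D₁`
  obtain ⟨iq, jq, hiq, hijq, eq1, heisq⟩ :=
    exists_image_coker_of_eq_mul hEis hT1 W₁ hNq hq hcop_q hW₁N D₁ hmin Sq
  obtain ⟨ip, jp, hip, hijp, ep1, heisp⟩ :=
    exists_image_coker_of_eq_mul hEis hT1 W₁ hNp hp hcop_p hW₁N D₁ hmin Sp
  -- Thm. 2.3 for `X₀^{pq}(M)` at `p` and at `q`, on `P`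
  obtain ⟨ip', jp', hip', hijp', -, ep2⟩ := hT2 hp rfl hadm X W hWN W' P hPm Sq
  obtain ⟨iq', jq', hiq', hijq', -, eq2⟩ := hT2 hq (mul_comm p q) hadm X W hWN W' P hPm Sp
  simp only [hL₁] at eq1 ep1 heisq heisp
  simp only [hL'] at ep2 eq2
  -- abbreviations
  set δ₁ := D₁.modularDegree
  set δ := P.deg
  set ξq := Sq.xi (fun n => W.LFunction n)
  set ξp := Sp.xi (fun n => W.LFunction n)
  set cp := (W.minimalDiscriminantNorm ℤ).factorization p
  set cq := (W.minimalDiscriminantNorm ℤ).factorization q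
  set c₁p := (W₁.minimalDiscriminantNorm ℤ).factorization p
  set c₁q := (W₁.minimalDiscriminantNorm ℤ).factorization q
  set c'p := (W'.minimalDiscriminantNorm ℤ).factorization p
  set c'q := (W'.minimalDiscriminantNorm ℤ).factorization q
  have hδ₁ : 0 < δ₁ := D₁.deg_pos
  have hδ : 0 < δ := P.deg_pos
  have hjq' : 0 < jq' := Nat.pos_of_ne_zero fun h0 => by
    rw [h0, mul_zero] at eq2; exact absurd eq2 (Nat.mul_pos hδ hiq').ne'
  have hjp' : 0 < jp' := Nat.pos_of_ne_zero fun h0 => by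
    rw [h0, mul_zero] at ep2; exact absurd ep2 (Nat.mul_pos hδ hip').ne'
  -- Prop. 6.13 at `d = 1`, both lines (Thm. 2.3 twice with the same `ξ`; Thm. 3.2 (a))
  have e613a : δ₁ * (ip ^ 2 * jq' ^ 2) = δ * (c₁p * c'q) := by
    calc δ₁ * (ip ^ 2 * jq' ^ 2) = (δ₁ * ip) * ip * jq' ^ 2 := by ring
      _ = ξp * jp * ip * jq' ^ 2 := by rw [ep1]
      _ = (ξp * jq') * (ip * jp) * jq' := by ring
      _ = (δ * iq') * c₁p * jq' := by rw [← eq2, hijp]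
      _ = δ * (c₁p * (iq' * jq')) := by ring
      _ = δ * (c₁p * c'q) := by rw [hijq']
  have e613b : δ₁ * (iq ^ 2 * jp' ^ 2) = δ * (c₁q * c'p) := by
    calc δ₁ * (iq ^ 2 * jp' ^ 2) = (δ₁ * iq) * iq * jp' ^ 2 := by ring
      _ = ξq * jq * iq * jp' ^ 2 := by rw [eq1]
      _ = (ξq * jp') * (iq * jq) * jp' := by ring
      _ = (δ * ip') * c₁q * jp' := by rw [← ep2, hijq]
      _ = δ * (c₁q * (ip' * jp')) := by ring
      _ = δ * (c₁q * c'p) := by rw [hijp']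
  -- Lemma 6.8 (Mazur–Kenku) for `A_{1,N}` and `A_{pq,M}` against `E`, at `p` and at `q`
  have h68 := fun (V V' : WeierstrassCurve ℚ) [V.IsElliptic] [V'.IsElliptic]
      (hiso : V.IsIsogenous V') (r : ℕ) (hr : r.Prime) (hrN : r ∣ V.conductorNorm ℤ)
      (hr2 : ¬ r ^ 2 ∣ V.conductorNorm ℤ) =>
    lemma_6_8_factorization_form (PastenShimura2024_lemma_6_8_of_mazurKenku' hMK) V V' hiso r hr
      hrN hr2
  have h68_1p := h68 W W₁ hiso₁' p hp hpN' hp2N'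
  have h68_1q := h68 W W₁ hiso₁' q hq hqN' hq2N'
  have h68_2p := h68 W W' hPm.1 p hp hpN' hp2N'
  have h68_2q := h68 W W' hPm.1 q hq hqN' hq2N'
  -- Lemma 6.14: `i_p(1,N), i_q(1,N) ∣ κ_S` (`N` squarefree away from `S`)
  have hi_p : ip ∣ κ₁ := h614 W hadm.pos hWN hS hip heisp
  have hi_q : iq ∣ κ₁ := h614 W hadm.pos hWN hS hiq heisq
  -- Lemma 6.15 for `j_q(pq,M)`: against `r = q` (same prime: `j'_q ∣ c_q(A_{pq,M})`, Lemma 6.8) …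
  have hjq_q : ∀ ℓ : ℕ, jq'.factorization ℓ ≤ cq.factorization ℓ + Nat.log ℓ 163 := fun ℓ => by
    obtain ⟨a, b, ha, ha', hb, hb', e⟩ := h68_2q
    exact factorization_le_of_dvd_of_mul_eq_mul (Dvd.intro_left _ hijq') ha ha' hb hb' hcqE e ℓ
  have hjp_p : ∀ ℓ : ℕ, jp'.factorization ℓ ≤ cp.factorization ℓ + Nat.log ℓ 163 := fun ℓ => by
    obtain ⟨a, b, ha, ha', hb, hb', e⟩ := h68_2p
    exact factorization_le_of_dvd_of_mul_eq_mul (Dvd.intro_left _ hijp') ha ha' hb hb' hcpE e ℓ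
  -- … and against `r = p` (switching primes between the two lines of Prop. 6.13)
  have hjq_p : ∀ ℓ : ℕ, jq'.factorization ℓ ≤ cp.factorization ℓ + α ℓ := fun ℓ => by
    have hsw := factorization_le_of_two_identities (K := κ₁.factorization ℓ) (ℓ := ℓ) hδ₁ hδ hiq
      hip hjq' hjp' hcqE hcpE e613b e613a h68_1q h68_2q h68_1p h68_2p
      (factorization_le_of_dvd_of_ne_zero (by omega) hi_q ℓ)
    have := hjp_p ℓ
    show _ ≤ _ + (κ₁.factorization ℓ + 3 * Nat.log ℓ 163)
    omega
  have hjdvd : jq' ∣ Nat.gcd cp cq * K :=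
    dvd_gcd_mul_prod_pow_of_factorization_le hjq'.ne' hcpE.ne' hcqE.ne' (fun ℓ _ => hjq_p ℓ)
      (fun ℓ _ => (hjq_q ℓ).trans (by simp only [hαdef]; omega)) hα0
  -- §6.9: the identity with bounded `a`, `b`
  obtain ⟨a₁, b₁, ha₁, ha₁', hb₁, hb₁', e₁⟩ := h68_1p
  obtain ⟨a₂, b₂, ha₂, ha₂', hb₂, hb₂', e₂⟩ := h68_2q
  set g := Nat.gcd cp cq
  have hile : ip ≤ κ₁ := Nat.le_of_dvd hκ₁ hi_p
  have hjle : jq' ≤ g * K := Nat.le_of_dvd (Nat.mul_pos (Nat.gcd_pos_of_pos_left _ hcpE) hK1) hjdvd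
  refine ⟨a₁ * a₂, ip ^ 2 * jq' ^ 2 * (b₁ * b₂), Nat.mul_pos ha₁ ha₂,
    Nat.mul_pos (Nat.mul_pos (pow_pos hip 2) (pow_pos hjq' 2)) (Nat.mul_pos hb₁ hb₂), ?_, ?_, ?_⟩
  · -- `a = a₁ a₂ ≤ 163²`
    rw [sq]
    exact Nat.mul_le_mul ha₁' ha₂'
  · -- `b = i² j² b₁ b₂ ≤ κ_S² (κ' gcd)² 163² = κ gcd²`
    calc ip ^ 2 * jq' ^ 2 * (b₁ * b₂) ≤ κ₁ ^ 2 * (g * K) ^ 2 * (163 * 163) :=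
          Nat.mul_le_mul (Nat.mul_le_mul (Nat.pow_le_pow_left hile 2) (Nat.pow_le_pow_left hjle 2))
            (Nat.mul_le_mul hb₁' hb₂')
      _ = 163 ^ 2 * κ₁ ^ 2 * K ^ 2 * g ^ 2 := by ring
  · -- the identity `δ_{1,N} b = a δ_{pq,M} c_p(E) c_q(E)`
    calc δ₁ * (ip ^ 2 * jq' ^ 2 * (b₁ * b₂))
        = δ₁ * (ip ^ 2 * jq' ^ 2) * (b₁ * b₂) := by ring
      _ = δ * (c₁p * c'q) * (b₁ * b₂) := by rw [e613a]
      _ = δ * ((c₁p * b₁) * (c'q * b₂)) := by ring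
      _ = δ * ((a₁ * cp) * (a₂ * cq)) := by rw [e₁, e₂]
      _ = a₁ * a₂ * δ * (cp * cq) := by ring

include hT2 hEis h67 in
/-- **The package from Takahashi's formulae, level input from Carayol's theorem**
(`IsNewformOf.level_eq_conductorNorm`, tree fact — a theorem of the tree granted the modularity
theorem, `IsNewformOf.level_eq_conductorNorm_of_exists_isNewformOf'`): the newform `D₁.f` of `W₁`
has level `N`, so `N_{W₁} = N`. [cite: PastenShimura2024, §6.9 (EqSequentially) p. 25 with d = 1] [cite: Carayol1986] -/
theorem PastenShimura2024_pairwise_denominator_of_takahashi_of_carayol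
    (hT1 : takahashi2001_thm_2_3_of_coprime) (hMK : mazurKenku_exists_cyclic_isogeny)
    (hCar : ∀ {N : ℕ} [NeZero N], IsNewformOf.level_eq_conductorNorm (N := N)) :
    PastenShimura2024_pairwise_denominator :=
  PastenShimura2024_pairwise_denominator_of_takahashi_of_level hT2 hEis h67 hT1 hMK
    fun D₁ _ _ _ _ => (hCar D₁.isNewformOf).symm

include hT2 hEis h67 in
/-- **The package from Takahashi's formulae, level input from the isogeny invariance of the
conductor** (`W₁ ∼ W` by Faltings, `isIsogenous_of_lFunction_prime_eq_of_not_dvd`, since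
`a_n(W₁) = a_n(D₁.f) = a_n(W)`; then `N_{W₁} = N_W = N`).
[cite: PastenShimura2024, §6.9 (EqSequentially) p. 25 with d = 1] [cite: Faltings1983Endlichkeit, §5 Korollar 2] -/
theorem PastenShimura2024_pairwise_denominator_of_takahashi_of_isogenyConductor
    (hT1 : takahashi2001_thm_2_3_of_coprime) (hMK : mazurKenku_exists_cyclic_isogeny)
    (hcond : ∀ (W W' : WeierstrassCurve ℚ) [W.IsElliptic] [W'.IsElliptic], W.IsIsogenous W' →
      W.conductorNorm ℤ = W'.conductorNorm ℤ) :
    PastenShimura2024_pairwise_denominator :=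
  PastenShimura2024_pairwise_denominator_of_takahashi_of_level hT2 hEis h67 hT1 hMK
    fun D₁ W _ hf hWN => by
      have hiso := isIsogenous_of_lFunction_prime_eq_of_not_dvd (N₀ := 1) one_ne_zero
        fun ℓ _ _ => by
          have h := (D₁.isNewformOf.2 ℓ).symm.trans (hf.2 ℓ)
          exact_mod_cast h
      exact (hcond _ _ hiso).trans hWN

include hT2 hEis h67 in
/-- **The package from Takahashi's formulae, level input from Ogg–Saito** (the conductor is an
isogeny invariant granted the tree's schema `artinConductorExponent_tate_eq_conductorExponent_of_isElliptic`
over `ℚ`, `conductorNorm_eq_of_isIsogenous_of_tate` — unconditional for curves not additive at `2`,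
Saito 1988 at `2`). So, over the tree, `PastenShimura2024_pairwise_denominator` follows from: the
named facts `takahashi2001_thm_2_3_of_coprime`, `mazurKenku_exists_cyclic_isogeny`, the Ogg–Saito
schema; and the three printed theorems `hT2` (Takahashi 2001, Thm. 2.3 at `p ∣ D` with Thm. 3.2 (a)),
`hEis` (Ribet 1990, Thm. 3.12), `h67` (Pasten's Lemma 6.7), each stated over the tree's vocabulary.
[cite: PastenShimura2024, §6.9 (EqSequentially) p. 25 with d = 1] [cite: SilvermanATAEC1994, Exercise 4.40 with §IV.10] -/
theorem PastenShimura2024_pairwise_denominator_of_takahashi_of_oggSaito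
    (hT1 : takahashi2001_thm_2_3_of_coprime) (hMK : mazurKenku_exists_cyclic_isogeny)
    (hOS : ∀ (W : WeierstrassCurve ℚ) (ℓ : ℕ) [Fact ℓ.Prime],
      W.artinConductorExponent_tate_eq_conductorExponent_of_isElliptic ℓ) :
    PastenShimura2024_pairwise_denominator :=
  PastenShimura2024_pairwise_denominator_of_takahashi_of_isogenyConductor hT2 hEis h67 hT1 hMK
    fun W W' _ _ hiso => conductorNorm_eq_of_isIsogenous_of_tate hOS W W' hiso

end Inputs

end Literature.NumberTheory.Automorphic

end
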